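import Mathlib
import Summits.MatrixMultiplication.MatrixMultiplication.Theses.LevelGradedCohnUmans
import Summits.MatrixMultiplication.MatrixMultiplication.Statement
import Literature.RepresentationTheory.FiniteGroups.CharacterDegrees
import Literature.RepresentationTheory.FiniteGroups.IrreducibleCharacters
import Summits.MatrixMultiplication.MatrixMultiplication.Theorems.LevelGradedCohnUmansGradedPricing
import Summits.MatrixMultiplication.MatrixMultiplication.Theorems.LevelGradedCohnUmansGradedDesignFamilyFrameSpan
import Summits.MatrixMultiplication.MatrixMultiplication.Theorems.LevelGradedCohnUmansGradedDesignFamilySharedWallLink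

/-!
# The quadratic-extension cell implies the crux — and `ω = 2`
# (crux `LevelGradedCohnUmans.GradedDesignFamily`, stmt-MatrixMultiplication-7610; line
# `quadratic-extension-level-one-cell`, lead c5 — part 2 of the line's landed reduction)

The line `quadratic-extension-level-one-cell` is CLOSED MODULO ONE registered stub, `stub_subfieldCell`
(S3): a constant `c > 0` and, over unboundedly large finite fields `k ⊂ K` with `|K| = |k|²`, an
embedding `φ : SL₂(k) ↪ GL₂(K)` and sets `Y, Z ⊆ GL₂(K)` of size `≥ c·|K|^{3/2}` such that for every
`z₀ ∈ Z` ONE frame function `g ↦ Σ_u cf u (g·u)` reads `[a = 1 ∧ y = y' ∧ z = z₀]` at `φ(a) y y'⁻¹ z`.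
With the host facts of `…GradedDesignFamilyFrameSpan.lean` (bi-invariance, budget `≤ 2^s Q^{1+s}`,
one-subgroup test) this file proves:

* `SubfieldCell.gradedDesignFamily_of_frameFamily` — prime-power UNIVERSALITY of the fixed cell
  `(m,k) = (2,1)`: level-one separated triples of sides `≥ c·|K|^{3/2}` along fields of unbounded
  order give the crux at EVERY `ε` (`|K|^{ε/2} > (2/c)^{2+ε}`);
* `gradedDesignFamily_of_subfieldCell` — **S3 ⟹ `GradedDesignFamily`** (hypothesis = the registered
  signature of `stub_subfieldCell`, verbatim; registered stub of the crux);
* `matrixMultiplication_of_subfieldCell`, `omega_eq_two_of_subfieldCell` — **S3 ⟹ `ω(ℂ) = 2`**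
  through the route's deciding theorem `closes` and the landed `GradedPricing_of`: the open stub of
  the line is SUMMIT-SIZED (kernel-checked certificate behind the lead's `promote-stub` verdict — a
  constructive close of the line is a proof of `ω = 2`);
* `omega_eq_two_of_lieCellFamilies` — the same certificate for the open stub of the line `Sketch`
  (`stub_lieCellFamilies`, via the landed `gradedDesignFamily_of_lieCellFamilies`).

[cite: CohnUmans2003 Prop 11; BlasiakCohnGrochowPrattUmans2024 Def 2.1/Thm 2.2;
CohnKleinbergSzegedyUmans2005 Thm 7.1]
-/

set_option linter.dupNamespace false

noncomputable section

open scoped BigOperators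
open Literature.RepresentationTheory.FiniteGroups
open Summit.MatrixMultiplication.MatrixMultiplication.Theses.LevelGradedCohnUmans

namespace Summit.MatrixMultiplication.MatrixMultiplication.Theorems.GradedDesignFamily

namespace SubfieldCell

/-! ## Universality of the fixed cell `(m,k) = (2,1)` over prime powers -/

/-- **Prime-power universality of the smallest Lie cell**: level-one (frame) separated triples in
`GL₂(K)` of sides `≥ c·|K|^{3/2}` along finite fields `K` of unbounded order give the crux at EVERY
`ε > 0` — the host `(GL₂(K), F₁(K))` is bi-invariant, frame separators are `F₁`-separators verbatim,
and the budget `≤ 2^{2+ε} Q^{3+ε}` loses to `V^{(2+ε)/3} ≥ c^{2+ε} Q^{3+3ε/2}` once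
`Q^{ε/2} > (2/c)^{2+ε}`.
[cite: BlasiakCohnGrochowPrattUmans2024, Def 2.1/Thm 2.2] -/
theorem gradedDesignFamily_of_frameFamily
    (hdesign : ∃ c : ℝ, 0 < c ∧ ∀ N : ℕ, ∃ (K : Type) (_ : Field K) (_ : Fintype K)
      (_ : DecidableEq K), N ≤ Fintype.card K ∧
      ∃ X Y Z : Finset (Matrix.GeneralLinearGroup (Fin 2) K),
        (∀ x₀ ∈ X, ∀ z₀ ∈ Z, ∃ c : (Fin 2 → K) → (Fin 2 → K) → ℂ,
          ∀ x ∈ X, ∀ y ∈ Y, ∀ y' ∈ Y, ∀ z ∈ Z,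
            (∑ u : Fin 2 → K, c u (((x⁻¹ * y * y'⁻¹ * z : Matrix.GeneralLinearGroup (Fin 2) K) :
                Matrix (Fin 2) (Fin 2) K).mulVec u)) =
              if x = x₀ ∧ y = y' ∧ z = z₀ then 1 else 0) ∧
        c * (Fintype.card K : ℝ) ^ (3 / 2 : ℝ) ≤ X.card ∧
        c * (Fintype.card K : ℝ) ^ (3 / 2 : ℝ) ≤ Y.card ∧
        c * (Fintype.card K : ℝ) ^ (3 / 2 : ℝ) ≤ Z.card) :
    GradedDesignFamily := by
  intro ε hε
  obtain ⟨c, hc, hall⟩ := hdesign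
  set s : ℝ := 2 + ε with hs_def
  have hs2 : 2 ≤ s := by rw [hs_def]; linarith
  set L : ℝ := (2 / c) ^ s with hL_def
  have hL : 0 ≤ L := by rw [hL_def]; positivity
  obtain ⟨N, hN⟩ := exists_nat_gt (max 1 (L ^ (2 / ε)))
  obtain ⟨K, instF, instFt, instD, hNK, X, Y, Z, hsep, hX, hY, hZ⟩ := hall N
  set Q : ℝ := (Fintype.card K : ℝ) with hQ_def
  have hNR : (N : ℝ) ≤ Q := by rw [hQ_def]; exact_mod_cast hNK
  have hQ1 : (1 : ℝ) < Q := lt_of_lt_of_le (lt_of_le_of_lt (le_max_left _ _) hN) hNR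
  have hQL : L ^ (2 / ε) < Q := lt_of_lt_of_le (lt_of_le_of_lt (le_max_right _ _) hN) hNR
  have hQ0 : (0 : ℝ) < Q := by linarith
  -- the key threshold: L < Q ^ (ε/2)
  have hLQ : L < Q ^ (ε / 2) := by
    have h1 : (L ^ (2 / ε)) ^ (ε / 2) < Q ^ (ε / 2) :=
      Real.rpow_lt_rpow (by positivity) hQL (by positivity)
    have h2 : (L ^ (2 / ε)) ^ (ε / 2) = L := by
      rw [← Real.rpow_mul hL]
      have : (2 / ε) * (ε / 2) = 1 := by field_simp
      rw [this, Real.rpow_one]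
    rwa [h2] at h1
  refine ⟨Matrix.GeneralLinearGroup (Fin 2) K, inferInstance, inferInstance,
    Submodule.span ℂ {f : Matrix.GeneralLinearGroup (Fin 2) K → ℂ |
      ∃ c : (Fin 2 → K) → (Fin 2 → K) → ℂ, f = fun g : Matrix.GeneralLinearGroup (Fin 2) K =>
        ∑ u : Fin 2 → K, c u ((g : Matrix (Fin 2) (Fin 2) K).mulVec u)},
    X, Y, Z, frameSpan_biInv K, ?_, ?_⟩
  · -- separation: frame separators are `F₁`-separators verbatim
    intro x₀ hx₀ z₀ hz₀
    obtain ⟨cf, hcf⟩ := hsep x₀ hx₀ z₀ hz₀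
    refine ⟨fun g => ∑ u : Fin 2 → K, cf u ((g : Matrix (Fin 2) (Fin 2) K).mulVec u),
      Submodule.subset_span ⟨cf, rfl⟩, fun x hx y hy y' hy' z hz => ⟨fun h => ?_, fun h => ?_⟩⟩
    · exact (hcf x hx y hy y' hy' z hz).trans (if_pos h)
    · exact (hcf x hx y hy y' hy' z hz).trans (if_neg h)
  · -- budget < volume^{s/3}
    have hB := frameBudget_le_pow K s hs2
    change (∑ᶠ χ ∈ irrChars (Matrix.GeneralLinearGroup (Fin 2) K) ∩
        ((Submodule.span ℂ {f : Matrix.GeneralLinearGroup (Fin 2) K → ℂ |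
          ∃ c : (Fin 2 → K) → (Fin 2 → K) → ℂ, f = fun g : Matrix.GeneralLinearGroup (Fin 2) K =>
            ∑ u : Fin 2 → K, c u ((g : Matrix (Fin 2) (Fin 2) K).mulVec u)} :
              Submodule ℂ (Matrix.GeneralLinearGroup (Fin 2) K → ℂ)) :
          Set (Matrix.GeneralLinearGroup (Fin 2) K → ℂ)), (χ 1).re ^ s) <
      ((X.card * Y.card * Z.card : ℕ) : ℝ) ^ (s / 3)
    -- lower bound for the volume side
    have hc32 : 0 < c * Q ^ (3 / 2 : ℝ) := by positivity
    have hXpos : (0 : ℝ) < X.card := lt_of_lt_of_le hc32 hX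
    have hYpos : (0 : ℝ) < Y.card := lt_of_lt_of_le hc32 hY
    have hZpos : (0 : ℝ) < Z.card := lt_of_lt_of_le hc32 hZ
    have hV : (c * Q ^ (3 / 2 : ℝ)) ^ (3 : ℕ) ≤ ((X.card * Y.card * Z.card : ℕ) : ℝ) := by
      push_cast
      have := mul_le_mul (mul_le_mul hX hY hc32.le hXpos.le) hZ hc32.le (by positivity)
      nlinarith [this]
    have hV' : ((c * Q ^ (3 / 2 : ℝ)) ^ (3 : ℕ)) ^ (s / 3) ≤
        ((X.card * Y.card * Z.card : ℕ) : ℝ) ^ (s / 3) :=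
      Real.rpow_le_rpow (by positivity) hV (by positivity)
    have hV'' : ((c * Q ^ (3 / 2 : ℝ)) ^ (3 : ℕ)) ^ (s / 3) = c ^ s * (Q ^ (1 + s) * Q ^ (ε / 2)) := by
      rw [← Real.rpow_natCast, ← Real.rpow_mul hc32.le]
      have h3 : ((3 : ℕ) : ℝ) * (s / 3) = s := by push_cast; ring
      rw [h3, Real.mul_rpow hc.le (by positivity), ← Real.rpow_mul hQ0.le, ← Real.rpow_add hQ0]
      congr 1
      congr 1
      rw [hs_def]; ring
    -- combine
    have hfinal : (2 : ℝ) ^ s * Q ^ (1 + s) < c ^ s * (Q ^ (1 + s) * Q ^ (ε / 2)) := by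
      have hcs : 0 < c ^ s := Real.rpow_pos_of_pos hc s
      have hQ1s : 0 < Q ^ (1 + s) := Real.rpow_pos_of_pos hQ0 _
      have hLc : c ^ s * L = (2 : ℝ) ^ s := by
        rw [hL_def, Real.div_rpow (by norm_num) hc.le]
        field_simp
      calc (2 : ℝ) ^ s * Q ^ (1 + s) = c ^ s * (Q ^ (1 + s) * L) := by rw [← hLc]; ring
        _ < c ^ s * (Q ^ (1 + s) * Q ^ (ε / 2)) := by gcongr
    calc (∑ᶠ χ ∈ irrChars (Matrix.GeneralLinearGroup (Fin 2) K) ∩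
          ((Submodule.span ℂ {f : Matrix.GeneralLinearGroup (Fin 2) K → ℂ |
            ∃ c : (Fin 2 → K) → (Fin 2 → K) → ℂ, f = fun g : Matrix.GeneralLinearGroup (Fin 2) K =>
              ∑ u : Fin 2 → K, c u ((g : Matrix (Fin 2) (Fin 2) K).mulVec u)} :
                Submodule ℂ (Matrix.GeneralLinearGroup (Fin 2) K → ℂ)) :
            Set (Matrix.GeneralLinearGroup (Fin 2) K → ℂ)), (χ 1).re ^ s)
          ≤ (2 : ℝ) ^ s * Q ^ (1 + s) := hB
      _ < c ^ s * (Q ^ (1 + s) * Q ^ (ε / 2)) := hfinal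
      _ = ((c * Q ^ (3 / 2 : ℝ)) ^ (3 : ℕ)) ^ (s / 3) := hV''.symm
      _ ≤ ((X.card * Y.card * Z.card : ℕ) : ℝ) ^ (s / 3) := hV'

end SubfieldCell

/-! ## S3 ⟹ crux ⟹ `ω = 2` -/

/-- **The quadratic-extension cell implies the crux**: the registered open stub `stub_subfieldCell` of
the line `quadratic-extension-level-one-cell` (hypothesis, verbatim) gives `GradedDesignFamily` — a
level-one family by the one-subgroup test (`X := φ(SL₂ k)`), then universality of the fixed cell.
[cite: CohnUmans2003, Prop 11; BlasiakCohnGrochowPrattUmans2024, Thm 2.2] -/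
theorem gradedDesignFamily_of_subfieldCell
    (h : ∃ c : ℝ, 0 < c ∧ ∀ N : ℕ, ∃ (k K : Type) (_ : Field k) (_ : Fintype k) (_ : DecidableEq k)
      (_ : Field K) (_ : Fintype K) (_ : DecidableEq K)
      (φ : Matrix.SpecialLinearGroup (Fin 2) k →* Matrix.GeneralLinearGroup (Fin 2) K),
      Function.Injective φ ∧ Fintype.card K = Fintype.card k ^ 2 ∧ N ≤ Fintype.card K ∧
      ∃ Y Z : Finset (Matrix.GeneralLinearGroup (Fin 2) K),
        c * (Fintype.card K : ℝ) ^ (3 / 2 : ℝ) ≤ (Finset.univ.image φ).card ∧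
        c * (Fintype.card K : ℝ) ^ (3 / 2 : ℝ) ≤ Y.card ∧
        c * (Fintype.card K : ℝ) ^ (3 / 2 : ℝ) ≤ Z.card ∧
        ∀ z₀ ∈ Z, ∃ cf : (Fin 2 → K) → (Fin 2 → K) → ℂ,
          ∀ a : Matrix.SpecialLinearGroup (Fin 2) k, ∀ y ∈ Y, ∀ y' ∈ Y, ∀ z ∈ Z,
            (∑ u : Fin 2 → K, cf u (((φ a * y * y'⁻¹ * z : Matrix.GeneralLinearGroup (Fin 2) K) :
                Matrix (Fin 2) (Fin 2) K).mulVec u)) =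
              if a = 1 ∧ y = y' ∧ z = z₀ then 1 else 0) :
    Summit.MatrixMultiplication.MatrixMultiplication.Theses.LevelGradedCohnUmans.GradedDesignFamily := by
  obtain ⟨c, hc, hall⟩ := h
  refine SubfieldCell.gradedDesignFamily_of_frameFamily ⟨c, hc, fun N => ?_⟩
  obtain ⟨k, K, _, _, _, _, _, _, φ, hφ, -, hN, Y, Z, hX, hY, hZ, hsep⟩ := hall N
  exact ⟨K, inferInstance, inferInstance, inferInstance, hN, Finset.univ.image φ, Y, Z,
    SubfieldCell.frameSeparated_image φ hφ Y Z hsep, hX, hY, hZ⟩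

/-- **The open stub of the line is SUMMIT-SIZED**: `stub_subfieldCell` implies the summit statement
`MatrixMultiplication` (`ω(ℂ) = 2`) through the route's deciding theorem `closes` fed with the landed
`GradedPricing_of`.  Kernel-checked certificate for the lead's `promote-stub` verdict: a constructive
close of the line is a proof of `ω = 2`. [cite: BlasiakCohnGrochowPrattUmans2024, Thm 2.2] -/
theorem matrixMultiplication_of_subfieldCell
    (h : ∃ c : ℝ, 0 < c ∧ ∀ N : ℕ, ∃ (k K : Type) (_ : Field k) (_ : Fintype k) (_ : DecidableEq k)
      (_ : Field K) (_ : Fintype K) (_ : DecidableEq K)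
      (φ : Matrix.SpecialLinearGroup (Fin 2) k →* Matrix.GeneralLinearGroup (Fin 2) K),
      Function.Injective φ ∧ Fintype.card K = Fintype.card k ^ 2 ∧ N ≤ Fintype.card K ∧
      ∃ Y Z : Finset (Matrix.GeneralLinearGroup (Fin 2) K),
        c * (Fintype.card K : ℝ) ^ (3 / 2 : ℝ) ≤ (Finset.univ.image φ).card ∧
        c * (Fintype.card K : ℝ) ^ (3 / 2 : ℝ) ≤ Y.card ∧
        c * (Fintype.card K : ℝ) ^ (3 / 2 : ℝ) ≤ Z.card ∧
        ∀ z₀ ∈ Z, ∃ cf : (Fin 2 → K) → (Fin 2 → K) → ℂ,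
          ∀ a : Matrix.SpecialLinearGroup (Fin 2) k, ∀ y ∈ Y, ∀ y' ∈ Y, ∀ z ∈ Z,
            (∑ u : Fin 2 → K, cf u (((φ a * y * y'⁻¹ * z : Matrix.GeneralLinearGroup (Fin 2) K) :
                Matrix (Fin 2) (Fin 2) K).mulVec u)) =
              if a = 1 ∧ y = y' ∧ z = z₀ then 1 else 0) :
    MatrixMultiplication :=
  closes GradedPricing.GradedPricing_of (gradedDesignFamily_of_subfieldCell h)

/-- `stub_subfieldCell ⟹ ω(ℂ) = 2` (the previous theorem through `MatrixMultiplication_iff`).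
[cite: BlasiakCohnGrochowPrattUmans2024, Thm 2.2] -/
theorem omega_eq_two_of_subfieldCell
    (h : ∃ c : ℝ, 0 < c ∧ ∀ N : ℕ, ∃ (k K : Type) (_ : Field k) (_ : Fintype k) (_ : DecidableEq k)
      (_ : Field K) (_ : Fintype K) (_ : DecidableEq K)
      (φ : Matrix.SpecialLinearGroup (Fin 2) k →* Matrix.GeneralLinearGroup (Fin 2) K),
      Function.Injective φ ∧ Fintype.card K = Fintype.card k ^ 2 ∧ N ≤ Fintype.card K ∧
      ∃ Y Z : Finset (Matrix.GeneralLinearGroup (Fin 2) K),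
        c * (Fintype.card K : ℝ) ^ (3 / 2 : ℝ) ≤ (Finset.univ.image φ).card ∧
        c * (Fintype.card K : ℝ) ^ (3 / 2 : ℝ) ≤ Y.card ∧
        c * (Fintype.card K : ℝ) ^ (3 / 2 : ℝ) ≤ Z.card ∧
        ∀ z₀ ∈ Z, ∃ cf : (Fin 2 → K) → (Fin 2 → K) → ℂ,
          ∀ a : Matrix.SpecialLinearGroup (Fin 2) k, ∀ y ∈ Y, ∀ y' ∈ Y, ∀ z ∈ Z,
            (∑ u : Fin 2 → K, cf u (((φ a * y * y'⁻¹ * z : Matrix.GeneralLinearGroup (Fin 2) K) :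
                Matrix (Fin 2) (Fin 2) K).mulVec u)) =
              if a = 1 ∧ y = y' ∧ z = z₀ then 1 else 0) :
    Literature.Computability.AlgebraicComplexity.omega ℂ = 2 :=
  MatrixMultiplication_iff.1 (matrixMultiplication_of_subfieldCell h)

/-- **The open stub of the line `Sketch` is summit-sized too**: `stub_lieCellFamilies` (shared-wall
graded STPP families in the Lie cells; hypothesis verbatim) implies `ω(ℂ) = 2`, through the landed
`gradedDesignFamily_of_lieCellFamilies` and `closes`. [cite: CohnKleinbergSzegedyUmans2005, Thm 7.1] -/
theorem omega_eq_two_of_lieCellFamilies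
    (hlie : ∃ c : ℝ, 0 < c ∧ ∀ R : ℝ, ∃ (p : ℕ) (_ : Fact p.Prime) (m k : ℕ)
      (F : Submodule ℂ (Matrix.GeneralLinearGroup (Fin m) (ZMod p) → ℂ)) (B₂ : ℝ) (t : ℕ)
      (X Y Z : Fin t → Finset (Matrix.GeneralLinearGroup (Fin m) (ZMod p))),
      F = Submodule.span ℂ {f | ∃ M : Matrix (Fin m) (Fin m) (ZMod p), M.rank ≤ k ∧
        f = fun g : Matrix.GeneralLinearGroup (Fin m) (ZMod p) =>
          (ZMod.stdAddChar (Matrix.trace (M * (g : Matrix (Fin m) (Fin m) (ZMod p)))) : ℂ)} ∧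
      B₂ = (∑ᶠ χ ∈ Literature.RepresentationTheory.FiniteGroups.irrChars
          (Matrix.GeneralLinearGroup (Fin m) (ZMod p)) ∩
        (F : Set (Matrix.GeneralLinearGroup (Fin m) (ZMod p) → ℂ)), (χ 1).re ^ (2 : ℝ)) ∧
      (∀ i : Fin t, ∀ x₀ ∈ X i, ∀ z₀ ∈ Z i, ∃ f ∈ F, ∀ j k : Fin t,
        ∀ x ∈ X j, ∀ y ∈ Y j, ∀ y' ∈ Y k, ∀ z ∈ Z k,
          ((j = i ∧ k = i ∧ x = x₀ ∧ y = y' ∧ z = z₀) → f (x⁻¹ * y * y'⁻¹ * z) = 1) ∧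
          (¬ (j = i ∧ k = i ∧ x = x₀ ∧ y = y' ∧ z = z₀) → f (x⁻¹ * y * y'⁻¹ * z) = 0)) ∧
      1 ≤ t ∧
      (∀ i, c * (B₂ / t) ^ (3 / 2 : ℝ) ≤ ((((X i).card * (Y i).card * (Z i).card : ℕ) : ℝ))) ∧
      (∀ χ ∈ Literature.RepresentationTheory.FiniteGroups.irrChars
          (Matrix.GeneralLinearGroup (Fin m) (ZMod p)) ∩
          (F : Set (Matrix.GeneralLinearGroup (Fin m) (ZMod p) → ℂ)),
        R * t * (χ 1).re ^ 2 ≤ B₂)) :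
    Literature.Computability.AlgebraicComplexity.omega ℂ = 2 :=
  MatrixMultiplication_iff.1
    (closes GradedPricing.GradedPricing_of (gradedDesignFamily_of_lieCellFamilies hlie))

end Summit.MatrixMultiplication.MatrixMultiplication.Theorems.GradedDesignFamily

end
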